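import Summits.AtomisticToContinuum.Crystallization.Theorems.FrustratedLawDichotomyStrainedPatchHomExteriorTaylor

/-!
# CHAINING CURVATURE FLOORS ALONG ONE RAY: the affine reparametrisation of `segGd` and slope growth under a PIECEWISE floor
# (27623 `(H) HomFloor`, hcp half; hand-1 g39; critic row 1470 (A4)/(A5): the «box-wise-floor FTC lemma» for the nested exterior E2′ and the chained annulus (β))

decomp-a2c hand-1 g39 (crux `AperiodicFrustratedLawGap`, stmt-AtomisticToContinuum-27623).  The curvature kit certifies a floor along a segment whose two end points
lie in ONE box (`…HomCurvLJAnisoM.curvLJ_floorM_of_check`).  To integrate the force growth along a ray that crosses SEVERAL certified boxes (the natural cell, the nested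
exterior boxes of E2′, the annulus boxes of (β)), the floor certified for a sub-segment `[s₁, s₂]` of the ray — stated by the kit for the base points `p_b + s₁Δ` and the
direction `(s₂ − s₁)Δ` — must be transported back to the original base points `p_b` and direction `Δ`, and the growth lemma must accept a floor profile that is only
piecewise differentiable as an antiderivative:

* §1 ★ `segGd_affine` — `segGd W₁ (p + s₁•Δ) (t•Δ) u = t² · segGd W₁ p Δ (s₁ + t·u)` (translation along the ray + degree-2 homogeneity in the direction), and
  its sum form `sum_segGd_affine`; so a floor `κ‖tΔ‖² ≤ Σ segGd W₁ (p_b + s₁Δ) (tΔ) u` on the sub-segment IS the floor `κ‖Δ‖² ≤ Σ segGd W₁ p_b Δ (s₁ + t u)` (`floor_transport`);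
* §2 ★ `slope_growth_of_curvature_pw` — `…HomExteriorTaylor.slope_growth_of_curvature_fn` with the antiderivative `K` continuous and differentiable only OFF a finite set `T`
  (break points of a piecewise-constant floor): `Σ segG … 0 + K s ≤ Σ segG … s` on `[0, 1]` (the break points join the finite exceptional set).

NO definitions; 0 sorry; standard axioms; no instances / notation / `#eval`.  `--supports stmt-AtomisticToContinuum-27623`.
-/

noncomputable section

namespace Summit.AtomisticToContinuum.Crystallization.Theorems.FrustratedLawDichotomyStrainedPatchHomExteriorTaylor

open scoped BigOperators RealInnerProductSpace
open Summit.AtomisticToContinuum.Crystallization.Theorems.FrustratedLawDichotomyStrainedPatchTaylorChord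
  (segR segN segS segG segGd segN_eq_inner segExc mem_segExc)
open Summit.AtomisticToContinuum.Crystallization.Theorems.FrustratedLawDichotomyStrainedPatchHomConvexSegment
  (monotoneOn_of_deriv_nonneg_off hasDerivAt_segG' continuousOn_segG)

/-! ## §1. Affine reparametrisation of the curvature summand -/

/-- The point of the reparametrised segment: `(p + s₁Δ) + u·(tΔ) = p + (s₁ + t u)Δ`. [arithmetic] -/
theorem seg_point_affine (p Δ : EuclideanSpace ℝ (Fin 3)) (s₁ t u : ℝ) : p + s₁ • Δ + u • (t • Δ) = p + (s₁ + t * u) • Δ := by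
  rw [smul_smul, add_smul, add_assoc, mul_comm u t]

/-- `segR` under the reparametrisation. [formal bookkeeping] -/
theorem segR_affine (p Δ : EuclideanSpace ℝ (Fin 3)) (s₁ t u : ℝ) : segR (p + s₁ • Δ) (t • Δ) u = segR p Δ (s₁ + t * u) := by
  simp only [segR, seg_point_affine]

/-- `segN` under the reparametrisation: `N′(u) = t · N(s₁ + t u)`. [arithmetic] -/
theorem segN_affine (p Δ : EuclideanSpace ℝ (Fin 3)) (s₁ t u : ℝ) : segN (p + s₁ • Δ) (t • Δ) u = t * segN p Δ (s₁ + t * u) := by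
  rw [segN_eq_inner, segN_eq_inner, seg_point_affine, real_inner_smul_right]

/-- `segS` under the reparametrisation: `S′(u) = t · S(s₁ + t u)`. [arithmetic] -/
theorem segS_affine (p Δ : EuclideanSpace ℝ (Fin 3)) (s₁ t u : ℝ) : segS (p + s₁ • Δ) (t • Δ) u = t * segS p Δ (s₁ + t * u) := by
  rw [segS, segS, segN_affine, segR_affine, mul_div_assoc]

/-- ★ **AFFINE REPARAMETRISATION OF THE CURVATURE SUMMAND**: `segGd W₁ (p + s₁Δ) (tΔ) u = t² · segGd W₁ p Δ (s₁ + t u)` — the curvature of a pair term along the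
sub-segment starting at parameter `s₁` with direction `tΔ` is `t²` times the curvature along the original ray at the corresponding parameter. [arithmetic] -/
theorem segGd_affine (W₁ : ℝ → ℝ) (p Δ : EuclideanSpace ℝ (Fin 3)) (s₁ t u : ℝ) :
    segGd W₁ (p + s₁ • Δ) (t • Δ) u = t ^ 2 * segGd W₁ p Δ (s₁ + t * u) := by
  have hn : ‖t • Δ‖ ^ 2 = t ^ 2 * ‖Δ‖ ^ 2 := by rw [norm_smul, mul_pow, Real.norm_eq_abs, sq_abs]
  simp only [segGd, segS_affine, segR_affine, segN_affine, hn]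
  ring

/-- The sum form of `segGd_affine`. [formal bookkeeping] -/
theorem sum_segGd_affine {ι : Type*} (S : Finset ι) (W₁ : ℝ → ℝ) (p : ι → EuclideanSpace ℝ (Fin 3)) (Δ : EuclideanSpace ℝ (Fin 3)) (s₁ t u : ℝ) :
    ∑ i ∈ S, segGd W₁ (p i + s₁ • Δ) (t • Δ) u = t ^ 2 * ∑ i ∈ S, segGd W₁ (p i) Δ (s₁ + t * u) := by
  rw [Finset.mul_sum]
  exact Finset.sum_congr rfl fun i _ => segGd_affine W₁ (p i) Δ s₁ t u

/-- ★ **FLOOR TRANSPORT**: a curvature floor certified on the sub-segment (base points `p_i + s₁Δ`, direction `tΔ`, `t ≠ 0`) — the shape the kit produces for a box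
containing that sub-segment — IS a floor along the original ray at the parameter `s₁ + t u`. [arithmetic] -/
theorem floor_transport {ι : Type*} (S : Finset ι) (W₁ : ℝ → ℝ) (p : ι → EuclideanSpace ℝ (Fin 3)) (Δ : EuclideanSpace ℝ (Fin 3)) {s₁ t u κ : ℝ}
    (ht : t ≠ 0) (h : κ * ‖t • Δ‖ ^ 2 ≤ ∑ i ∈ S, segGd W₁ (p i + s₁ • Δ) (t • Δ) u) :
    κ * ‖Δ‖ ^ 2 ≤ ∑ i ∈ S, segGd W₁ (p i) Δ (s₁ + t * u) := by
  rw [sum_segGd_affine, norm_smul, mul_pow, Real.norm_eq_abs, sq_abs] at h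
  have ht2 : 0 < t ^ 2 := by positivity
  nlinarith

/-! ## §2. Slope growth under a piecewise floor (antiderivative differentiable off a finite set) -/

/-- ★ **SLOPE GROWTH FROM A PIECEWISE CURVATURE-SUM FLOOR**: as `slope_growth_of_curvature_fn`, but the antiderivative `K` of the floor profile `κ` need only be
CONTINUOUS on `[0, 1]` and differentiable off a finite set `T` (the break points of a piecewise-constant floor chained from several certified boxes).
`Σ_i segG … 0 + K s ≤ Σ_i segG … s` on `[0, 1]`. [folklore: the break points join the finite exceptional set of the monotonicity lemma] -/
theorem slope_growth_of_curvature_pw {ι : Type*} (S : Finset ι) (p : ι → EuclideanSpace ℝ (Fin 3)) {Δ : EuclideanSpace ℝ (Fin 3)} (hΔ : Δ ≠ 0)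
    {W₁ : ℝ → ℝ} (J : Finset ℝ) {a b : ℝ} {κ K : ℝ → ℝ} (T : Finset ℝ) (ha : 0 < a) (hcont : ContinuousOn W₁ (Set.Icc a b))
    (hdiff : ∀ r, a < r → r < b → r ∉ J → HasDerivAt W₁ (deriv W₁ r) r)
    (htube : ∀ i ∈ S, ∀ s ∈ Set.Icc (0 : ℝ) 1, a ≤ ‖p i + s • Δ‖ ∧ ‖p i + s • Δ‖ ≤ b)
    (hK0 : K 0 = 0) (hKc : ContinuousOn K (Set.Icc 0 1)) (hK : ∀ s, s ∉ T → HasDerivAt K (κ s) s)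
    (hcurv : ∀ s ∈ Set.Ioo (0 : ℝ) 1, (∀ i ∈ S, a < segR (p i) Δ s ∧ segR (p i) Δ s < b ∧ segR (p i) Δ s ∉ J) →
      κ s ≤ ∑ i ∈ S, segGd W₁ (p i) Δ s) :
    ∀ s ∈ Set.Icc (0 : ℝ) 1, ∑ i ∈ S, segG W₁ (p i) Δ 0 + K s ≤ ∑ i ∈ S, segG W₁ (p i) Δ s := by
  classical
  set h : ℝ → ℝ := fun s => ∑ i ∈ S, segG W₁ (p i) Δ s - K s with hh
  set X : Finset ℝ := S.biUnion (fun i => segExc (p i) Δ (insert a (insert b J))) ∪ T with hX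
  -- good parameters: every radius avoids `{a, b} ∪ J`, and `K` is differentiable
  have good : ∀ s ∈ Set.Ioo (0 : ℝ) 1, s ∉ X → (∀ i ∈ S, a < segR (p i) Δ s ∧ segR (p i) Δ s < b ∧ segR (p i) Δ s ∉ J) ∧ s ∉ T := by
    intro s hs hsX
    have hsX' : s ∉ S.biUnion (fun i => segExc (p i) Δ (insert a (insert b J))) := fun hm => hsX (Finset.mem_union_left _ hm)
    have hsT : s ∉ T := fun hm => hsX (Finset.mem_union_right _ hm)
    refine ⟨fun i hi => ?_, hsT⟩
    have hnot : segR (p i) Δ s ∉ insert a (insert b J) := fun hmem =>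
      hsX' (Finset.mem_biUnion.2 ⟨i, hi, mem_segExc hΔ hmem⟩)
    simp only [Finset.mem_insert, not_or] at hnot
    obtain ⟨hna, hnb, hnJ⟩ := hnot
    have ht := htube i hi s (Set.Ioo_subset_Icc_self hs)
    exact ⟨lt_of_le_of_ne ht.1 (Ne.symm hna), lt_of_le_of_ne ht.2 hnb, hnJ⟩
  have hcontH : ContinuousOn h (Set.Icc 0 1) := by
    have h1 : ContinuousOn (fun s => ∑ i ∈ S, segG W₁ (p i) Δ s) (Set.Icc 0 1) :=
      continuousOn_finsetSum S fun i hi => continuousOn_segG hcont ha (htube i hi)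
    exact h1.sub hKc
  have hderH : ∀ s ∈ Set.Ioo (0 : ℝ) 1, s ∉ X → HasDerivAt h (∑ i ∈ S, segGd W₁ (p i) Δ s - κ s) s := by
    intro s hs hsX
    obtain ⟨hg, hsT⟩ := good s hs hsX
    have hsum : HasDerivAt (fun t => ∑ i ∈ S, segG W₁ (p i) Δ t) (∑ i ∈ S, segGd W₁ (p i) Δ s) s := by
      refine HasDerivAt.fun_sum fun i hi => ?_
      obtain ⟨h1, h2, h3⟩ := hg i hi
      exact hasDerivAt_segG' (ha.trans h1).ne' (hdiff _ h1 h2 h3)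
    exact hsum.sub (hK s hsT)
  have hnn : ∀ s ∈ Set.Ioo (0 : ℝ) 1, s ∉ X → 0 ≤ ∑ i ∈ S, segGd W₁ (p i) Δ s - κ s :=
    fun s hs hsX => sub_nonneg.2 (hcurv s hs (good s hs hsX).1)
  intro s hs
  have hmono := monotoneOn_of_deriv_nonneg_off X hcontH hderH hnn 0 s le_rfl hs.2 hs.1
  simp only [hh, hK0, sub_zero] at hmono
  linarith

end Summit.AtomisticToContinuum.Crystallization.Theorems.FrustratedLawDichotomyStrainedPatchHomExteriorTaylor

end
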